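import Literature.AlgebraicGeometry.HodgeTheory.PolarizedLimitMixedHodgeStructurePeriodMapHolomorphicGauge
import Mathlib.Analysis.Analytic.Uniqueness
import Mathlib.Analysis.SpecialFunctions.ExpDeriv
import Mathlib.Analysis.Complex.Convex
import HarnessLib

/-!
# The Hodge locus of a vector under a one-variable period map in the holomorphic gauge is analytic: on each half-plane `{Im z > A}` it is
# everything or has no accumulation point (the interior identity principle; Cattani–Deligne–Kaplan §1, Voisin II Lemma 5.13)

Topic `Literature/AlgebraicGeometry/HodgeTheory` (namespace `Literature.AlgebraicGeometry.HodgeTheory.PolarizedLimitMixedHodgeStructure`; the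
basis-level analyticity tools of §1 are in `…Motives` / `…Motives.MixedHodgeStructure`), a leaf on
`PolarizedLimitMixedHodgeStructurePeriodMapHolomorphicGauge.lean` (the gauge `Φ(z) = exp(zN_ℂ)·exp(Γ(e^{2πiz}))·F`, matrix-coefficient
holomorphy, `𝔟` nilpotent).  THEOREMS ONLY (no definition, no named fact, no instance; D-0026 net debt `0`).

PRINTED SOURCES, VERBATIM.  E. Cattani, P. Deligne, A. Kaplan, *On the locus of Hodge classes*, J. Amer. Math. Soc. 8 (1995), §1 (p. 483):
«The Hodge filtration `ℱ_t` of `H^{2p}(X_t, ℂ)`, `t ∈ U`, can be viewed as a variable filtration on the fixed complex vector space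
`H^{2p}(X_s, ℂ)`. It varies holomorphically with `t`. It follows that the locus `T ⊂ U` where `h` remains of type `(p, p)`, i.e., in `ℱ^p`,
is a complex analytic subspace of `U`.»; 2.3 (p. 487): «(2.3.1) `Φ(z) = exp(Σ z_jN_j) Ψ(s)` (`s = e^{2πiz}`) for some holomorphic map `Ψ`
from `Dʳ` to the flag manifold of `V`»; 2.7 (p. 489): «(2.7.1) `Φ(z) = exp(Σ z_jN_j) exp(Γ(s)) F` … with `Γ` holomorphic at `s = 0`,
`𝔟`-valued».  C. Voisin, *Hodge Theory and Complex Algebraic Geometry II*, §5.3.1 Lemma 5.13: «the sets `U_λ^p` are analytic subsets of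
`U`».

THE SETTING (one variable).  `L = (W, F, N, Q)` a polarized limit mixed Hodge structure of weight `k` on the finite-dimensional
`ℚ`-space `V`; `Γ : ℂ → End(V_ℂ)` with `Γ(s) ∈ 𝔟 = ⊕_{a ≤ −1} gl^{a,b}` and EVERY MATRIX COEFFICIENT `s ↦ φ(Γ(s)w)` ANALYTIC AT EVERY POINT
OF THE DISC `|s| < ρ` («`Ψ` holomorphic on `D`»); `Φ^p(z) = exp(zN_ℂ)·exp(Γ(e^{2πiz}))·F^p` on the half-plane `{Im z > A}` with
`e^{−2πA} ≤ ρ`.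

WHAT IS PROVED.
* §1 (tools «in a basis») weak analyticity is stable under powers and the finite exponential: `s ↦ φ(Γ(s)^i w)` and `s ↦ φ(exp(Γ(s))w)` are
  analytic at `s₀` when all matrix coefficients are (`Motives.analyticAt_apply_pow_apply`, `Motives.analyticAt_apply_exp_apply`); a
  uniform exponent `n` with `X^n = 0` for all `X ∈ 𝔟` (`MixedHodgeStructure.exists_forall_pow_eq_zero_of_mem_biSup_endPiece`).
* §2 the locus equations in the annihilator of `F^p`: **`v ∈ exp(Y)·exp(X)·S ⟺ exp(−X)exp(−Y)v ∈ S`** (`mem_map_map_exp_iff_exp_neg_apply_mem`)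
  and `⟺ φ(exp(−X)exp(−Y)v) = 0` for all `φ ∈ (F^p)^⊥` (`mem_map_map_exp_F_iff_forall_dualAnnihilator`).
* §3 **THE HODGE-LOCUS EQUATIONS ARE HOLOMORPHIC IN `z`**: `z ↦ φ(exp(−Γ(e^{2πiz})) exp(−zN_ℂ) v)` is analytic at every `z` with `Im z > A`
  (`analyticAt_dual_apply_exp_neg_gauge_exp_neg_smul_N_apply`) — «It varies holomorphically with `t`».
* §4 **THE HODGE LOCUS OF ANY `v ∈ V_ℂ` ON THE HALF-PLANE `{Im z > A}` IS EVERYTHING OR HAS NO ACCUMULATION POINT IN IT**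
  (`forall_mem_or_forall_eventually_not_mem_of_analytic`): either `v ∈ Φ^p(z)` for all `z` with `Im z > A`, or every `z₀` with `Im z₀ > A`
  has a punctured neighbourhood on which `v ∉ Φ^p(z)` («the locus … is a complex analytic subspace of `U`» — in dimension one, all of the
  connected `U` or discrete in it; identity principle on the convex half-plane).  For bounded integral classes the sequel sharpens «no
  accumulation point in the half-plane» to «no point at all near the puncture» (`…HodgeLocusNearPuncture.lean`).

NOT HERE: several variables; analytic subspaces as ringed spaces.

## References

* [CattaniDeligneKaplan1995] E. Cattani, P. Deligne, A. Kaplan, *On the locus of Hodge classes*, J. Amer. Math. Soc. 8 (1995) 483–506: §1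
  (p. 483), 2.3 (2.3.1) (p. 487), 2.7 (2.7.1)–(2.7.2) (p. 489), 2.10 (p. 490).
* [VoisinHodgeII2003] C. Voisin, *Hodge Theory and Complex Algebraic Geometry II*, CUP (2003): §5.3.1 Lemma 5.13.
* [FritzscheGrauert2002] K. Fritzsche, H. Grauert, *From Holomorphic Functions to Complex Manifolds*, GTM 213 (2002): Ch. I §8 (zero sets
  of holomorphic functions; the identity theorem).
-/

noncomputable section

open scoped TensorProduct ComplexOrder
open Filter Topology

namespace Literature.AlgebraicGeometry

open Module
open Motives Motives.MixedHodgeStructure Motives.HodgeStructure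

universe u

variable {V : Type u} [AddCommGroup V] [Module ℚ V] [FiniteDimensional ℚ V]

/-! ## §1 Weak analyticity is stable under powers and the exponential; a uniform nilpotency exponent on `𝔟` -/

namespace Motives

/-- **`s ↦ φ(Γ(s)^i w)` is analytic at `s₀`** when every matrix coefficient `s ↦ φ(Γ(s)w)` is: `Γ(s)^{i+1}w = Σ_m c_m(s) Γ(s)b_m` with
`c_m(s)` the coordinates of `Γ(s)^i w` in a basis `(b_m)` («writing (2.7.3) in a basis of `V_ℚ`», 2.10). [cite: CattaniDeligneKaplan1995, 2.10 (p. 490) and §1 (p. 483)] -/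
theorem analyticAt_apply_pow_apply (Γ : ℂ → Module.End ℂ (ℂ ⊗[ℚ] V)) {s₀ : ℂ}
    (hΓan : ∀ (φ : Module.Dual ℂ (ℂ ⊗[ℚ] V)) (w : ℂ ⊗[ℚ] V), AnalyticAt ℂ (fun s => φ (Γ s w)) s₀) (i : ℕ)
    (φ : Module.Dual ℂ (ℂ ⊗[ℚ] V)) (w : ℂ ⊗[ℚ] V) : AnalyticAt ℂ (fun s => φ ((Γ s ^ i) w)) s₀ := by
  classical
  induction i generalizing φ w with
  | zero => simp only [pow_zero, Module.End.one_apply]; exact analyticAt_const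
  | succ i ih =>
    set b := Module.finBasis ℂ (ℂ ⊗[ℚ] V)
    have key : ∀ s, φ ((Γ s ^ (i + 1)) w) = ∑ m, b.coord m ((Γ s ^ i) w) * φ (Γ s (b m)) := fun s => by
      rw [pow_succ', Module.End.mul_apply]
      conv_lhs => rw [← b.sum_repr ((Γ s ^ i) w)]
      rw [map_sum, map_sum]
      refine Finset.sum_congr rfl fun m _ => ?_
      rw [map_smul, map_smul, smul_eq_mul, Basis.coord_apply]
    simp_rw [key]
    exact Finset.analyticAt_fun_sum _ fun m _ => (ih (b.coord m) w).mul (hΓan φ (b m))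

/-- **`s ↦ φ(exp(Γ(s))w)` is analytic at `s₀`** when every matrix coefficient is and `Γ(s)^n = 0` for all `s` (`exp = Σ_{i<n} Γ(s)^i/i!`).
[cite: CattaniDeligneKaplan1995, 2.7 (2.7.1) (p. 489) and 2.10 (p. 490)] -/
theorem analyticAt_apply_exp_apply (Γ : ℂ → Module.End ℂ (ℂ ⊗[ℚ] V)) {s₀ : ℂ}
    (hΓan : ∀ (φ : Module.Dual ℂ (ℂ ⊗[ℚ] V)) (w : ℂ ⊗[ℚ] V), AnalyticAt ℂ (fun s => φ (Γ s w)) s₀) {n : ℕ}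
    (hn : ∀ s : ℂ, Γ s ^ n = 0) (φ : Module.Dual ℂ (ℂ ⊗[ℚ] V)) (w : ℂ ⊗[ℚ] V) :
    AnalyticAt ℂ (fun s => φ (IsNilpotent.exp (Γ s) w)) s₀ := by
  have key : ∀ s, φ (IsNilpotent.exp (Γ s) w) = ∑ i ∈ Finset.range n, (((i.factorial : ℚ)⁻¹ : ℚ) : ℂ) * φ ((Γ s ^ i) w) := fun s => by
    rw [IsNilpotent.exp_eq_sum (hn s), LinearMap.sum_apply, map_sum]
    refine Finset.sum_congr rfl fun i _ => ?_
    rw [LinearMap.smul_apply, ← Rat.cast_smul_eq_qsmul ℂ, map_smul, smul_eq_mul]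
  simp_rw [key]
  exact Finset.analyticAt_fun_sum _ fun i _ => analyticAt_const.mul (analyticAt_apply_pow_apply Γ hΓan i φ w)

omit [FiniteDimensional ℚ V] in
/-- Matrix coefficients of `−Γ` are analytic when those of `Γ` are. [cite: CattaniDeligneKaplan1995, 2.10 (p. 490)] -/
theorem analyticAt_dual_neg_apply (Γ : ℂ → Module.End ℂ (ℂ ⊗[ℚ] V)) {s₀ : ℂ}
    (hΓan : ∀ (φ : Module.Dual ℂ (ℂ ⊗[ℚ] V)) (w : ℂ ⊗[ℚ] V), AnalyticAt ℂ (fun s => φ (Γ s w)) s₀)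
    (φ : Module.Dual ℂ (ℂ ⊗[ℚ] V)) (w : ℂ ⊗[ℚ] V) : AnalyticAt ℂ (fun s => φ ((-Γ s) w)) s₀ := by
  simp_rw [LinearMap.neg_apply, map_neg]
  exact (hΓan φ w).neg

end Motives

namespace Motives.MixedHodgeStructure

/-- **A uniform nilpotency exponent on `𝔟`**: in finite dimension there is `n` with `X^n = 0` for every `X ∈ 𝔟 = ⊕_{a ≤ −1} gl^{a,b}`
(`X^n(V_ℂ) = X^n(U_M) ⊆ U_{M−n} = 0`). [cite: CattaniDeligneKaplan1995, 2.7 (p. 489) ("the nilpotent subalgebra 𝔟")] [cite: CattaniElZeinGriffithsLe2014, §7.6 (7.6.3)] -/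
theorem exists_forall_pow_eq_zero_of_mem_biSup_endPiece (H : MixedHodgeStructure V) :
    ∃ n : ℕ, ∀ X : Module.End ℂ (ℂ ⊗[ℚ] V), X ∈ (⨆ ab ∈ {ab : ℤ × ℤ | ab.1 ≤ -1}, H.endPiece ab.1 ab.2) → X ^ n = 0 := by
  obtain ⟨M, hM⟩ := H.exists_forall_fst_le_of_deligneFamily_ne_bot
  obtain ⟨m, hm⟩ := H.exists_forall_le_fst_of_deligneFamily_ne_bot
  refine ⟨(M - m).toNat + 1, fun X hX => LinearMap.ext fun w => ?_⟩
  have hXl := H.apply_mem_biSup_fst_le_pred_of_mem_biSup_endPiece hX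
  have hw : w ∈ ⨆ pq ∈ {pq : ℤ × ℤ | pq.1 ≤ M}, H.deligneFamily pq := by
    rw [H.biSup_fst_le_eq_top_of_forall hM]; exact Submodule.mem_top
  have h := pow_apply_mem_biSup_fst_le_sub hXl ((M - m).toNat + 1) M hw
  have hlt : M - (((M - m).toNat + 1 : ℕ) : ℤ) < m := by
    have := Int.self_le_toNat (M - m)
    push_cast
    omega
  rw [H.biSup_fst_le_eq_bot_of_forall hm hlt, Submodule.mem_bot] at h
  rw [h, LinearMap.zero_apply]

end Motives.MixedHodgeStructure

namespace HodgeTheory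

namespace PolarizedLimitMixedHodgeStructure

variable {k : ℤ} (L : PolarizedLimitMixedHodgeStructure V k)

/-! ## §0 Tools -/

omit [FiniteDimensional ℚ V] in
/-- `|e^{2πiz}| = e^{−2π Im z}`. [folklore] -/
private theorem norm_cexp_two_pi_I_mul''' (z : ℂ) :
    ‖Complex.exp (2 * Real.pi * Complex.I * z)‖ = Real.exp (-(2 * Real.pi) * z.im) := by
  rw [Complex.norm_exp]
  congr 1
  simp [Complex.mul_re, Complex.mul_im]

omit [FiniteDimensional ℚ V] in
/-- For `A < Im z` and `e^{−2πA} ≤ ρ`: `|e^{2πiz}| < ρ`. [folklore] -/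
private theorem norm_cexp_lt_of_lt_im {ρ A : ℝ} (hρA : Real.exp (-(2 * Real.pi) * A) ≤ ρ) {z : ℂ} (hz : A < z.im) :
    ‖Complex.exp (2 * Real.pi * Complex.I * z)‖ < ρ := by
  rw [norm_cexp_two_pi_I_mul''']
  refine lt_of_lt_of_le (Real.exp_lt_exp.2 ?_) hρA
  nlinarith [Real.pi_pos]

omit [FiniteDimensional ℚ V] in
/-- `z ↦ e^{2πiz}` is analytic. [folklore] -/
private theorem analyticAt_cexp_two_pi_I_mul (z : ℂ) : AnalyticAt ℂ (fun z : ℂ => Complex.exp (2 * Real.pi * Complex.I * z)) z :=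
  analyticAt_cexp.comp (analyticAt_const.mul analyticAt_id)

/-! ## §2 The locus equations in the annihilator of `F^p` -/

omit [FiniteDimensional ℚ V] in
/-- **`v ∈ exp(Y)·exp(X)·S ⟺ exp(−X)(exp(−Y)v) ∈ S`** for nilpotent `X`, `Y` and any subspace `S` (the flag `Φ^p(z) = exp(zN)exp(Γ(s))F^p` pulled
back by the inverse automorphism: «`(exp(Σ z_jN_j) exp(Γ(s)))^{-1}(v) ∈ F⁰`»). [cite: CattaniDeligneKaplan1995, 2.7 (2.7.2) (p. 489)] -/
theorem mem_map_map_exp_iff_exp_neg_apply_mem {X Y : Module.End ℂ (ℂ ⊗[ℚ] V)} (hX : IsNilpotent X) (hY : IsNilpotent Y)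
    (S : Submodule ℂ (ℂ ⊗[ℚ] V)) (v : ℂ ⊗[ℚ] V) :
    v ∈ (S.map (IsNilpotent.exp X)).map (IsNilpotent.exp Y) ↔ IsNilpotent.exp (-X) (IsNilpotent.exp (-Y) v) ∈ S := by
  constructor
  · rintro ⟨w, ⟨x, hx, rfl⟩, rfl⟩
    rw [← Module.End.mul_apply (IsNilpotent.exp (-Y)), IsNilpotent.exp_neg_mul_exp_self hY, Module.End.one_apply,
      ← Module.End.mul_apply, IsNilpotent.exp_neg_mul_exp_self hX, Module.End.one_apply]
    exact hx
  · intro h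
    refine ⟨IsNilpotent.exp (-Y) v, ⟨_, h, ?_⟩, ?_⟩
    · rw [← Module.End.mul_apply, IsNilpotent.exp_mul_exp_neg_self hX, Module.End.one_apply]
    · rw [← Module.End.mul_apply, IsNilpotent.exp_mul_exp_neg_self hY, Module.End.one_apply]

/-- **The Hodge locus equations**: for `X ∈ 𝔟` and any `z`, `v ∈ exp(zN_ℂ)·exp(X)·F^p` if and only if **`φ(exp(−X) exp(−zN_ℂ) v) = 0` for every
`φ` in the annihilator of `F^p`** (finitely many linear equations on a vector depending holomorphically on the point).
[cite: CattaniDeligneKaplan1995, §1 (p. 483) ("i.e., in ℱ^p") and 2.7 (2.7.2) (p. 489)] -/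
theorem mem_map_map_exp_F_iff_forall_dualAnnihilator {X : Module.End ℂ (ℂ ⊗[ℚ] V)}
    (hX : X ∈ ⨆ ab ∈ {ab : ℤ × ℤ | ab.1 ≤ -1}, L.toMixedHodgeStructure.endPiece ab.1 ab.2) (p : ℤ) (z : ℂ) (v : ℂ ⊗[ℚ] V) :
    v ∈ ((L.F p).map (IsNilpotent.exp X)).map (IsNilpotent.exp (z • L.N.baseChange ℂ)) ↔
      ∀ φ : Module.Dual ℂ (ℂ ⊗[ℚ] V), φ ∈ (L.F p).dualAnnihilator →
        φ (IsNilpotent.exp (-X) (IsNilpotent.exp (-(z • L.N.baseChange ℂ)) v)) = 0 := by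
  rw [mem_map_map_exp_iff_exp_neg_apply_mem (L.toMixedHodgeStructure.isNilpotent_of_mem_biSup_endPiece hX)
    (L.isNilpotent_N_baseChange.smul z), ← Subspace.forall_mem_dualAnnihilator_apply_eq_zero_iff]

/-! ## §3 The Hodge-locus equations are holomorphic in `z` -/

/-- **`z ↦ φ(exp(−Γ(e^{2πiz})) exp(−zN_ℂ) v)` is analytic at every `z` with `Im z > A`** (`e^{−2πA} ≤ ρ`), for `Γ(s) ∈ 𝔟` with matrix
coefficients analytic on the disc `|s| < ρ`: «`ℱ_t` … varies holomorphically with `t`» — `exp(−zN)v` is a polynomial in `z`, `exp(−Γ(s))` a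
polynomial in `Γ(s)`, and `s = e^{2πiz}`. [cite: CattaniDeligneKaplan1995, §1 (p. 483), 2.3 (2.3.1) (p. 487), 2.7 (2.7.1) (p. 489)] -/
theorem analyticAt_dual_apply_exp_neg_gauge_exp_neg_smul_N_apply (Γ : ℂ → Module.End ℂ (ℂ ⊗[ℚ] V)) {ρ A : ℝ}
    (hρA : Real.exp (-(2 * Real.pi) * A) ≤ ρ)
    (hΓan : ∀ s : ℂ, ‖s‖ < ρ → ∀ (φ : Module.Dual ℂ (ℂ ⊗[ℚ] V)) (w : ℂ ⊗[ℚ] V), AnalyticAt ℂ (fun s => φ (Γ s w)) s)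
    (hΓb : ∀ s : ℂ, Γ s ∈ ⨆ ab ∈ {ab : ℤ × ℤ | ab.1 ≤ -1}, L.toMixedHodgeStructure.endPiece ab.1 ab.2)
    (φ : Module.Dual ℂ (ℂ ⊗[ℚ] V)) (v : ℂ ⊗[ℚ] V) {z₀ : ℂ} (hz₀ : A < z₀.im) :
    AnalyticAt ℂ (fun z : ℂ => φ (IsNilpotent.exp (-Γ (Complex.exp (2 * Real.pi * Complex.I * z)))
      (IsNilpotent.exp (-(z • L.N.baseChange ℂ)) v))) z₀ := by
  -- a uniform exponent for `−Γ(s) ∈ 𝔟` and for `N_ℂ`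
  obtain ⟨n, hn⟩ := L.toMixedHodgeStructure.exists_forall_pow_eq_zero_of_mem_biSup_endPiece
  have hnΓ : ∀ s : ℂ, (-Γ s) ^ n = 0 := fun s => hn _ (Submodule.neg_mem _ (hΓb s))
  obtain ⟨d, hd⟩ := L.isNilpotent_N_baseChange
  -- expand `exp(−zN) v` as a polynomial in `z` with vector coefficients
  have hexpN : ∀ z : ℂ, IsNilpotent.exp (-(z • L.N.baseChange ℂ)) v =
      ∑ j ∈ Finset.range d, ((((j.factorial : ℚ)⁻¹ : ℚ) : ℂ) * (-z) ^ j) • (L.N.baseChange ℂ ^ j) v := fun z => by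
    rw [show -(z • L.N.baseChange ℂ) = (-z) • L.N.baseChange ℂ from (neg_smul _ _).symm]
    have hdz : ((-z) • L.N.baseChange ℂ) ^ d = 0 := by rw [smul_pow, hd, smul_zero]
    rw [IsNilpotent.exp_eq_sum hdz, LinearMap.sum_apply]
    refine Finset.sum_congr rfl fun j _ => ?_
    rw [LinearMap.smul_apply, ← Rat.cast_smul_eq_qsmul ℂ, smul_pow, LinearMap.smul_apply, smul_smul]
  have key : ∀ z : ℂ, φ (IsNilpotent.exp (-Γ (Complex.exp (2 * Real.pi * Complex.I * z))) (IsNilpotent.exp (-(z • L.N.baseChange ℂ)) v)) =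
      ∑ j ∈ Finset.range d, ((((j.factorial : ℚ)⁻¹ : ℚ) : ℂ) * (-z) ^ j) *
        φ (IsNilpotent.exp (-Γ (Complex.exp (2 * Real.pi * Complex.I * z))) ((L.N.baseChange ℂ ^ j) v)) := fun z => by
    rw [hexpN, map_sum, map_sum]
    refine Finset.sum_congr rfl fun j _ => ?_
    rw [map_smul, map_smul, smul_eq_mul]
  simp_rw [key]
  refine Finset.analyticAt_fun_sum _ fun j _ => ?_
  refine (analyticAt_const.mul ((analyticAt_id.neg).pow j)).mul ?_
  -- the outer function `s ↦ φ(exp(−Γ(s)) w)` is analytic at `s(z₀)`, `|s(z₀)| < ρ`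
  have hs₀ : ‖Complex.exp (2 * Real.pi * Complex.I * z₀)‖ < ρ := norm_cexp_lt_of_lt_im hρA hz₀
  have hout : AnalyticAt ℂ (fun s => φ (IsNilpotent.exp (-Γ s) ((L.N.baseChange ℂ ^ j) v))) (Complex.exp (2 * Real.pi * Complex.I * z₀)) :=
    Motives.analyticAt_apply_exp_apply (fun s => -Γ s) (Motives.analyticAt_dual_neg_apply Γ (hΓan _ hs₀)) hnΓ φ _
  exact AnalyticAt.comp (g := fun s => φ (IsNilpotent.exp (-Γ s) ((L.N.baseChange ℂ ^ j) v)))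
    (f := fun z : ℂ => Complex.exp (2 * Real.pi * Complex.I * z)) (x := z₀) hout (analyticAt_cexp_two_pi_I_mul z₀)

/-! ## §4 Everything or no accumulation point, on each half-plane -/

/-- **THE HODGE LOCUS OF A VECTOR IS ANALYTIC (ONE VARIABLE): ON THE HALF-PLANE `{Im z > A}` IT IS EVERYTHING OR HAS NO ACCUMULATION
POINT.**  `L` a polarized limit mixed Hodge structure, `Γ(s) ∈ 𝔟` with matrix coefficients analytic on `|s| < ρ`, `e^{−2πA} ≤ ρ`,
`Φ^p(z) = exp(zN_ℂ)·exp(Γ(e^{2πiz}))·F^p`.  For every `v ∈ V_ℂ`: EITHER `v ∈ Φ^p(z)` for all `z` with `Im z > A`, OR every `z₀` with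
`Im z₀ > A` has a punctured neighbourhood on which `v ∉ Φ^p(z)` («the locus `T ⊂ U` where `h` remains of type `(p, p)`, i.e., in `ℱ^p`, is
a complex analytic subspace of `U`»: the common zero set of the holomorphic functions `z ↦ φ(exp(−Γ(s))exp(−zN)v)`, `φ ∈ (F^p)^⊥`, on the
connected half-plane — identity principle). [cite: CattaniDeligneKaplan1995, §1 (p. 483), 2.7 (2.7.1)–(2.7.2) (p. 489), 2.10 (p. 490)]
[cite: VoisinHodgeII2003, §5.3.1 Lemma 5.13] [cite: FritzscheGrauert2002, Ch. I §8] -/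
theorem forall_mem_or_forall_eventually_not_mem_of_analytic (Γ : ℂ → Module.End ℂ (ℂ ⊗[ℚ] V)) {ρ A : ℝ}
    (hρA : Real.exp (-(2 * Real.pi) * A) ≤ ρ)
    (hΓan : ∀ s : ℂ, ‖s‖ < ρ → ∀ (φ : Module.Dual ℂ (ℂ ⊗[ℚ] V)) (w : ℂ ⊗[ℚ] V), AnalyticAt ℂ (fun s => φ (Γ s w)) s)
    (hΓb : ∀ s : ℂ, Γ s ∈ ⨆ ab ∈ {ab : ℤ × ℤ | ab.1 ≤ -1}, L.toMixedHodgeStructure.endPiece ab.1 ab.2) (p : ℤ) (v : ℂ ⊗[ℚ] V) :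
    (∀ z : ℂ, A < z.im →
        v ∈ ((L.F p).map (IsNilpotent.exp (Γ (Complex.exp (2 * Real.pi * Complex.I * z))))).map
          (IsNilpotent.exp (z • L.N.baseChange ℂ))) ∨
      (∀ z₀ : ℂ, A < z₀.im → ∀ᶠ z in 𝓝[≠] z₀,
        v ∉ ((L.F p).map (IsNilpotent.exp (Γ (Complex.exp (2 * Real.pi * Complex.I * z))))).map
          (IsNilpotent.exp (z • L.N.baseChange ℂ))) := by
  -- the locus equations `F_φ(z) = 0`, `φ ∈ (F^p)^⊥`
  set Fφ : Module.Dual ℂ (ℂ ⊗[ℚ] V) → ℂ → ℂ := fun φ z =>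
    φ (IsNilpotent.exp (-Γ (Complex.exp (2 * Real.pi * Complex.I * z))) (IsNilpotent.exp (-(z • L.N.baseChange ℂ)) v)) with hFφ
  have hiff : ∀ z : ℂ, v ∈ ((L.F p).map (IsNilpotent.exp (Γ (Complex.exp (2 * Real.pi * Complex.I * z))))).map
      (IsNilpotent.exp (z • L.N.baseChange ℂ)) ↔ ∀ φ : Module.Dual ℂ (ℂ ⊗[ℚ] V), φ ∈ (L.F p).dualAnnihilator → Fφ φ z = 0 :=
    fun z => L.mem_map_map_exp_F_iff_forall_dualAnnihilator (hΓb _) p z v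
  by_cases h : ∀ φ : Module.Dual ℂ (ℂ ⊗[ℚ] V), φ ∈ (L.F p).dualAnnihilator → ∀ z : ℂ, A < z.im → Fφ φ z = 0
  · exact Or.inl fun z hz => (hiff z).2 fun φ hφ => h φ hφ z hz
  · right
    simp only [not_forall] at h
    obtain ⟨φ, hφ, z₁, hz₁, hne⟩ := h
    intro z₀ hz₀
    -- `F_φ` is analytic on the preconnected half-plane and not identically zero there
    have han : AnalyticOnNhd ℂ (Fφ φ) {z : ℂ | A < z.im} := fun z hz =>
      L.analyticAt_dual_apply_exp_neg_gauge_exp_neg_smul_N_apply Γ hρA hΓan hΓb φ v hz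
    have hnot : ¬ (∀ᶠ z in 𝓝 z₀, Fφ φ z = 0) := fun hev => by
      have hzero := han.eqOn_zero_of_preconnected_of_eventuallyEq_zero (convex_halfSpace_im_gt A).isPreconnected hz₀ hev
      exact hne (hzero hz₁)
    filter_upwards [(han z₀ hz₀).eventually_eq_zero_or_eventually_ne_zero.resolve_left hnot] with z hz hmem
    exact hz ((hiff z).1 hmem φ hφ)

end PolarizedLimitMixedHodgeStructure

end HodgeTheory

end Literature.AlgebraicGeometry
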